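import Summits.QuantumFields.BalabanUV.T4Continuum.Support.NE3CombGauge
import Summits.QuantumFields.BalabanUV.T4Continuum.Support.SkeletonLattice
import Summits.QuantumFields.BalabanUV.T4Continuum.Support.AveragingDeficitPeriodicCounting
import Summits.QuantumFields.BalabanUV.T4Continuum.Support.NE3CovariantBlockPoincare
import HarnessLib

/-!
# NE7CombGenerator — THE LINEARISED BLOCK-COMB (complete axial) GAUGE: for EVERY background `W` and EVERY 1-form `X` there is a CORNER-TRIVIAL generator `ξ`
# with `gaugeDir W ξ = X` on the in-block comb bonds of the `M`-blocks; everything about `ξ` (sup `≤ d(M−1)·sup_comb‖X‖`, `‖gaugeDir W ξ‖ ≤ 2d(M−1)·…`,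
# skewness, periodicity) follows from «corner-trivial + comb-solve» ALONE, and existence is the closed formula `ξ = −Ad_{btree⁻¹}·Σ_{Γ} Ad_{btree(b⁺)}X(b)`
# along row NE3's comb transport `btree` (file 73 of the curved (APE): (c₂) BY GAUGE CHOICE, kinematic half)

Cell `pub-balaban`, rung (B)+1 sub-cell t4, lineage `b2b-balaban-t4-ne7-p1` (CRUX PROVER NE7 #1 = OWNER of row NE7), generation 81; memo
`t4/b2b-balaban-t4-ne7-p1-g81/COMB-SLICE.md`.  File F143, over row NE3's `NE3CombGauge` (`btree`, `comb_eq_one_of_lowPart`: the comb bonds are trivial in the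
comb gauge), `SkeletonLattice` (`cdiv ∕ cmod` block coordinates), `NE3CovariantBlockPoincare.Ad_inv_Ad`, the Literature transcriptions `B7Prop1Explicit` (`treeWord`, `asum`, `seg`) and
`B8Lemma1NonAbelian` (`lowPart`, the `s ++ μ :: t` splitting of the tree word) BY NAME.
WHY.  After g80 the curved (APE) END (`NE7ApeCurvedRepRoadBGradientClassH`, p586320) consumes the homogeneous slice-solver letter (L2)ʰ, and F137∕F139∕F142 reduce
(L2)ʰ on all tangent fields to (c₁) the letter on ANY gauge-fixed class `S_L` plus (c₂) a decomposition `X = X_L + gaugeDir W ξ` (`X_L ∈ S_L`, `ξ` corner-trivial)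
with two sup bounds `‖ξ‖_∞ ≤ C_ξ‖X‖_∞`, `‖gaugeDir W ξ‖_∞ ≤ C_H‖X‖_∞`.  With `S_L := T_♮(W)` (row NE3's ℓ²-orthogonal slice) the two bounds are ℓ^∞ bounds of a
zeroth∕minus-first order singular integral at a curved background, PINNED at the corners — g80 memo §7 (corner spikes: `C_H ≍ M` expected) and §8 (`log M`).  THIS
file takes the OTHER freedom F137 left open — the CHOICE of `S_L` — and supplies the decomposition for the block-COMB slice `S_comb := {Y : Y = 0 on every in-block
comb bond}` by pure kinematics: the generator is obtained by solving `gaugeDir W ξ = X` outward along the comb of each block (a spanning tree of the block rooted at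
its corner), so `C_ξ = d(M−1)` and `C_H = 2d(M−1)` with NO analysis, at EVERY unitary `W`, level-free and volume-free.  (The price moves into the ONE remaining
letter: (c₁) on `S_comb`, whose slope must then be `K_X ≲ 1∕M²` instead of `≲ 1∕M` — memo §2; F144 does the bookkeeping.)
WHAT ([folklore]; 0 def, 0 sorry — the generator enters as a HYPOTHESIS-CARRYING variable `ξ` with `hξ0` (corner-trivial) and `hsol` (comb-solve); §4 proves one exists).
§1 block-comb combinatorics: `cmod_corner`∕`eq_corner_of_cmod_eq_zero`, `l1_cmod_le` (`|y mod M|₁ ≤ d(M−1)`), **`exists_comb_pred`** (every non-corner site is the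
   endpoint `z + e_μ` of an in-block comb bond `(z, μ)` — `μ` = the lowest axis with non-zero offset — with `|z mod M|₁ + 1 = |y mod M|₁`);
§2 consequences of «`ξ(M•w) = 0` ∧ `gaugeDir W ξ = X` on in-block comb bonds» by induction on `|y mod M|₁`: `comb_step`, **`norm_le_l1_of_combSolve`**
   (`‖ξ y‖ ≤ |y mod M|₁·G`, `G` = sup of `‖X‖` over the in-block comb bonds ONLY, `W` unitary), **`norm_le_of_combSolve`** (`≤ d(M−1)·G`),
   **`norm_gaugeDir_le_of_combSolve`** (`≤ 2d(M−1)·G` on every bond), **`skew_of_combSolve`**, **`periodic_of_combSolve`** (period `N·M` of `W`, `X` ⟹ of `ξ`),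
   `comb_vanish_of_combSolve` (`X − gaugeDir W ξ = 0` on the in-block comb bonds);
§3 `asum_seg_natCast_succ`, **`asum_treeWord_add_e`** (the tree-word sum grows by the last bond when the low coordinates vanish);
§4 **`exists_combSolve`** — for EVERY `W` (no unitarity, no smallness) and every `X`: `∃ ξ`, corner-trivial ∧ comb-solve; witness
   `ξ(y) = −Ad_{btree(y)⁻¹} asum (b ↦ Ad_{btree(b⁺)} X(b)) (M•⌊y∕M⌋) (treeWord (y mod M))`, the solve identity being `comb_eq_one_of_lowPart` (`btree(z)·W(z,μ) = btree(z+e_μ)`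
   on comb bonds) + `asum_treeWord_add_e`.
HONEST FRAMING (page 1): lattice kinematics at one configuration; nothing of Bałaban's asserted (context: the complete axial gauge of [Balaban1985Averaging] p. 24 ∕
[Balaban1984PropagatorsI] (1.7), here LINEARISED); the slice solver is NOT touched; (APE) on curved data NOT proved; NOT ONE-STEP, NOT NE7; spine 0∕9; finite T⁴
rung (B)+1 — NOT infinite volume, NOT mass gap, NOT `BetaPertH`, NOT Clay.  Continuum YM on T⁴ ⇐ BetaPertH ∧ nine spine estimates (0/9 proved); BetaPertH ⇐ (D1) ∧ (D4) ∧
CAP+tail; G-an2-4 gates asym, D1 and NE2/3/4.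
-/

set_option autoImplicit false

open scoped BigOperators Matrix.Norms.L2Operator
open NormedSpace Finset

namespace Summit.QuantumFields.BalabanUV.T4Continuum.NE7CombGenerator

open Literature.MathematicalPhysics.QuantumFieldTheory.Balaban1983to89
open B7Prop1Explicit B7Prop2Explicit
open B8Lemma1NonAbelian (lowPart lowPart_apply pairwise_gt_finRange_reverse)
open T4AveragingDeficitWall (Ad IsUnitaryCfg IsSkewDir)
open T4AveragingDeficitWallBoundary (IsPeriodicCfg)
open T4AveragingDeficitNonAbelian (Ad_mul Ad_sub)
open AveragingDeficitNearIdentity (Ad_add Ad_neg Ad_zero)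
open AveragingDeficitPeriodicCounting (IsPeriodicDir)
open AveragingDeficitTransport (norm_Ad_of_unitary Ad_mem_skewAdjoint)
open AveragingDeficitBlockDensity (btree btree_mem)
open NE3CombGauge (comb_eq_one_of_lowPart lowPart_eq_zero_iff)
open NE3CovariantBlockPoincare (Ad_inv_Ad)
open BlockAveragePushDirGauge (gaugeDir)
open SkeletonLattice (cmod cdiv smul_cdiv_add_cmod cmod_nonneg cmod_lt cdiv_eq_of_repr cmod_eq_of_repr cmod_add_period)

noncomputable section

variable {d : ℕ} {n : Type*} [Fintype n] [DecidableEq n]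

/-! ## §1 Block-comb combinatorics -/

section Lattice

variable {M : ℕ}

omit [Fintype n] [DecidableEq n] in
/-- Corners have zero offset: `(M•w) mod M = 0`. [folklore] -/
theorem cmod_corner (hM : 1 ≤ M) (w : Site d) : cmod M ((M : ℤ) • w) = 0 :=
  cmod_eq_of_repr (z := w) (by simp) (fun _ => le_rfl) (fun _ => by simp only [Pi.zero_apply]; exact_mod_cast hM)

omit [Fintype n] [DecidableEq n] in
/-- A site with zero offset is the corner of its block: `y = M•⌊y∕M⌋`. [folklore] -/
theorem eq_corner_of_cmod_eq_zero {y : Site d} (hy : cmod M y = 0) : y = (M : ℤ) • cdiv M y := by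
  have h := smul_cdiv_add_cmod M y
  rw [hy, add_zero] at h
  exact h.symm

omit [Fintype n] [DecidableEq n] in
/-- `|y mod M|₁ ≤ d(M−1)`. [folklore] -/
theorem l1_cmod_le (hM : 1 ≤ M) (y : Site d) : (l1 (cmod M y) : ℝ) ≤ (d : ℝ) * ((M : ℝ) - 1) := by
  unfold l1
  have hM1 : ((M - 1 : ℕ) : ℝ) = (M : ℝ) - 1 := by rw [Nat.cast_sub hM, Nat.cast_one]
  have hb : ∀ κ : Fin d, (cmod M y κ).natAbs ≤ M - 1 := fun κ => by
    have h0 := cmod_nonneg hM y κ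
    have h1 := cmod_lt hM y κ
    omega
  calc ((∑ κ : Fin d, (cmod M y κ).natAbs : ℕ) : ℝ) = ∑ κ : Fin d, ((cmod M y κ).natAbs : ℝ) := by push_cast; rfl
    _ ≤ ∑ _κ : Fin d, ((M : ℝ) - 1) := Finset.sum_le_sum fun κ _ => by rw [← hM1]; exact_mod_cast hb κ
    _ = (d : ℝ) * ((M : ℝ) - 1) := by rw [Finset.sum_const, Finset.card_univ, Fintype.card_fin, nsmul_eq_mul]

omit [Fintype n] [DecidableEq n] in
/-- `|v|₁ = 0` forces `v = 0`. [folklore] -/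
theorem eq_zero_of_l1_eq_zero {v : Site d} (hv : l1 v = 0) : v = 0 := by
  funext κ
  have h := (Finset.sum_eq_zero_iff.mp hv) κ (Finset.mem_univ κ)
  exact Int.natAbs_eq_zero.mp h

omit [Fintype n] [DecidableEq n] in
/-- **EVERY NON-CORNER SITE IS THE ENDPOINT OF AN IN-BLOCK COMB BOND**: if `y mod M ≠ 0` and `μ` is the lowest axis with `(y mod M)_μ ≠ 0`, then with `z = y − e_μ`:
`y = z + e_μ`, `(z mod M)_κ = 0` for `κ < μ`, `(z mod M)_μ + 1 < M`, and `|z mod M|₁ + 1 = |y mod M|₁`. [folklore] -/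
theorem exists_comb_pred (hM : 1 ≤ M) {y : Site d} (hy : cmod M y ≠ 0) :
    ∃ (z : Site d) (μ : Fin d), y = z + e μ ∧ (∀ κ, κ < μ → cmod M z κ = 0) ∧ cmod M z μ + 1 < (M : ℤ) ∧
      l1 (cmod M z) + 1 = l1 (cmod M y) := by
  classical
  have hne : (Finset.univ.filter fun κ : Fin d => cmod M y κ ≠ 0).Nonempty := by
    by_contra h
    rw [Finset.not_nonempty_iff_eq_empty, Finset.filter_eq_empty_iff] at h
    exact hy (funext fun κ => by simpa using h (Finset.mem_univ κ))
  set μ : Fin d := (Finset.univ.filter fun κ : Fin d => cmod M y κ ≠ 0).min' hne with hμdef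
  have hμmem : cmod M y μ ≠ 0 := (Finset.mem_filter.mp (Finset.min'_mem _ hne)).2
  have hμmin : ∀ κ, cmod M y κ ≠ 0 → μ ≤ κ := fun κ hκ =>
    Finset.min'_le _ κ (Finset.mem_filter.mpr ⟨Finset.mem_univ κ, hκ⟩)
  have hμpos : 1 ≤ cmod M y μ := by
    have := cmod_nonneg hM y μ
    omega
  have hrepr : y - e μ = (M : ℤ) • cdiv M y + (cmod M y - e μ) := by
    have h := smul_cdiv_add_cmod M y
    rw [add_sub_assoc', h]
  have hq0 : ∀ i, 0 ≤ (cmod M y - e μ) i := fun i => by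
    simp only [Pi.sub_apply, e_apply]
    split_ifs with h
    · subst h; omega
    · have := cmod_nonneg hM y i; omega
  have hqM : ∀ i, (cmod M y - e μ) i < M := fun i => by
    simp only [Pi.sub_apply, e_apply]
    have := cmod_lt hM y i
    split_ifs <;> omega
  have hcm : cmod M (y - e μ) = cmod M y - e μ := cmod_eq_of_repr hrepr hq0 hqM
  refine ⟨y - e μ, μ, by abel, ?_, ?_, ?_⟩
  · intro κ hκ
    rw [hcm, Pi.sub_apply, e_apply, if_neg (ne_of_lt hκ), sub_zero]
    by_contra h
    exact absurd (hμmin κ h) (not_le.mpr hκ)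
  · rw [hcm, Pi.sub_apply, e_apply, if_pos rfl]
    have := cmod_lt hM y μ
    omega
  · rw [hcm]
    unfold l1
    rw [← Finset.add_sum_erase _ _ (Finset.mem_univ μ), ← Finset.add_sum_erase _ (fun κ => (cmod M y κ).natAbs) (Finset.mem_univ μ)]
    have hrest : ∑ κ ∈ Finset.univ.erase μ, ((cmod M y - e μ) κ).natAbs = ∑ κ ∈ Finset.univ.erase μ, (cmod M y κ).natAbs :=
      Finset.sum_congr rfl fun κ hκ => by
        rw [Pi.sub_apply, e_apply, if_neg (Finset.ne_of_mem_erase hκ), sub_zero]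
    rw [hrest, Pi.sub_apply, e_apply, if_pos rfl]
    omega

end Lattice

/-! ## §2 Consequences of «corner-trivial + comb-solve» -/

section Solve

variable {W : Site d → Fin d → (Matrix n n ℂ)ˣ} {M : ℕ} (hM : 1 ≤ M) {X : Site d → Fin d → Matrix n n ℂ} {ξ : Site d → Matrix n n ℂ}
  (hξ0 : ∀ w : Site d, ξ ((M : ℤ) • w) = 0)
  (hsol : ∀ (z : Site d) (μ : Fin d), (∀ κ, κ < μ → cmod M z κ = 0) → cmod M z μ + 1 < (M : ℤ) → gaugeDir W ξ z μ = X z μ)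

include hsol in
/-- One comb bond: `ξ(z + e_μ) = Ad_{W(z,μ)⁻¹} ξ(z) − X(z,μ)`. [folklore] -/
theorem comb_step {z : Site d} {μ : Fin d} (hlow : ∀ κ, κ < μ → cmod M z κ = 0) (hin : cmod M z μ + 1 < (M : ℤ)) :
    ξ (z + e μ) = Ad (W z μ)⁻¹ (ξ z) - X z μ := by
  have h := hsol z μ hlow hin
  simp only [gaugeDir] at h
  rw [← h, sub_sub_cancel]

omit [Fintype n] [DecidableEq n] in
include hξ0 in
/-- Corner-triviality at a site of zero offset. [folklore] -/
theorem eq_zero_of_cmod_eq_zero {y : Site d} (hy : cmod M y = 0) : ξ y = 0 := by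
  rw [eq_corner_of_cmod_eq_zero hy]; exact hξ0 _

include hM hξ0 hsol in
/-- **THE SUP SHAPE ALONG THE COMB**: `W` unitary, `‖X‖ ≤ G` on the in-block comb bonds ⟹ `‖ξ y‖ ≤ |y mod M|₁·G`. [folklore] -/
theorem norm_le_l1_of_combSolve (hW : IsUnitaryCfg W) {G : ℝ}
    (hG : ∀ (z : Site d) (μ : Fin d), (∀ κ, κ < μ → cmod M z κ = 0) → cmod M z μ + 1 < (M : ℤ) → ‖X z μ‖ ≤ G) :
    ∀ y : Site d, ‖ξ y‖ ≤ (l1 (cmod M y) : ℝ) * G := by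
  suffices h : ∀ (k : ℕ) (y : Site d), l1 (cmod M y) = k → ‖ξ y‖ ≤ (k : ℝ) * G by
    intro y; exact h _ y rfl
  intro k
  induction k with
  | zero =>
      intro y hy
      rw [eq_zero_of_cmod_eq_zero hξ0 (eq_zero_of_l1_eq_zero hy), norm_zero, Nat.cast_zero, zero_mul]
  | succ k ih =>
      intro y hy
      have hy0 : cmod M y ≠ 0 := fun h => by rw [h] at hy; simp [l1] at hy
      obtain ⟨z, μ, rfl, hlow, hin, hl1⟩ := exists_comb_pred hM hy0
      have hk : l1 (cmod M z) = k := by omega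
      have hz := ih z hk
      rw [comb_step hsol hlow hin]
      have hAd : ‖Ad (W z μ)⁻¹ (ξ z)‖ = ‖ξ z‖ := norm_Ad_of_unitary ((unitaryUnits _).inv_mem (hW z μ)) _
      calc ‖Ad (W z μ)⁻¹ (ξ z) - X z μ‖ ≤ ‖Ad (W z μ)⁻¹ (ξ z)‖ + ‖X z μ‖ := norm_sub_le _ _
        _ ≤ (k : ℝ) * G + G := by rw [hAd]; exact add_le_add hz (hG z μ hlow hin)
        _ = ((k + 1 : ℕ) : ℝ) * G := by push_cast; ring

include hM hξ0 hsol in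
/-- **`‖ξ‖_∞ ≤ d(M−1)·G`** (`G ≥ 0` a bound of `‖X‖` on the in-block comb bonds, `W` unitary). [folklore] -/
theorem norm_le_of_combSolve (hW : IsUnitaryCfg W) {G : ℝ} (hG0 : 0 ≤ G)
    (hG : ∀ (z : Site d) (μ : Fin d), (∀ κ, κ < μ → cmod M z κ = 0) → cmod M z μ + 1 < (M : ℤ) → ‖X z μ‖ ≤ G) (y : Site d) :
    ‖ξ y‖ ≤ (d : ℝ) * ((M : ℝ) - 1) * G :=
  (norm_le_l1_of_combSolve hM hξ0 hsol hW hG y).trans (mul_le_mul_of_nonneg_right (l1_cmod_le hM y) hG0)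

include hM hξ0 hsol in
/-- **`‖gaugeDir W ξ‖_∞ ≤ 2d(M−1)·G`** on EVERY bond (on the comb bonds it is `X` itself). [folklore] -/
theorem norm_gaugeDir_le_of_combSolve (hW : IsUnitaryCfg W) {G : ℝ} (hG0 : 0 ≤ G)
    (hG : ∀ (z : Site d) (μ : Fin d), (∀ κ, κ < μ → cmod M z κ = 0) → cmod M z μ + 1 < (M : ℤ) → ‖X z μ‖ ≤ G) (z : Site d) (μ : Fin d) :
    ‖gaugeDir W ξ z μ‖ ≤ 2 * ((d : ℝ) * ((M : ℝ) - 1) * G) := by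
  have hAd : ‖Ad (W z μ)⁻¹ (ξ z)‖ = ‖ξ z‖ := norm_Ad_of_unitary ((unitaryUnits _).inv_mem (hW z μ)) _
  calc ‖gaugeDir W ξ z μ‖ = ‖Ad (W z μ)⁻¹ (ξ z) - ξ (z + e μ)‖ := rfl
    _ ≤ ‖Ad (W z μ)⁻¹ (ξ z)‖ + ‖ξ (z + e μ)‖ := norm_sub_le _ _
    _ ≤ (d : ℝ) * ((M : ℝ) - 1) * G + (d : ℝ) * ((M : ℝ) - 1) * G := by
        rw [hAd]; exact add_le_add (norm_le_of_combSolve hM hξ0 hsol hW hG0 hG z) (norm_le_of_combSolve hM hξ0 hsol hW hG0 hG _)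
    _ = 2 * ((d : ℝ) * ((M : ℝ) - 1) * G) := by ring

include hM hξ0 hsol in
/-- **SKEWNESS**: `W` unitary and `X` skew on the in-block comb bonds ⟹ `ξ` is `𝔲(n)`-valued. [folklore] -/
theorem skew_of_combSolve (hW : IsUnitaryCfg W)
    (hX : ∀ (z : Site d) (μ : Fin d), (∀ κ, κ < μ → cmod M z κ = 0) → cmod M z μ + 1 < (M : ℤ) → X z μ ∈ skewAdjoint (Matrix n n ℂ)) :
    ∀ y : Site d, ξ y ∈ skewAdjoint (Matrix n n ℂ) := by
  suffices h : ∀ (k : ℕ) (y : Site d), l1 (cmod M y) = k → ξ y ∈ skewAdjoint (Matrix n n ℂ) by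
    intro y; exact h _ y rfl
  intro k
  induction k with
  | zero =>
      intro y hy
      rw [eq_zero_of_cmod_eq_zero hξ0 (eq_zero_of_l1_eq_zero hy)]
      exact (skewAdjoint _).zero_mem
  | succ k ih =>
      intro y hy
      have hy0 : cmod M y ≠ 0 := fun h => by rw [h] at hy; simp [l1] at hy
      obtain ⟨z, μ, rfl, hlow, hin, hl1⟩ := exists_comb_pred hM hy0
      have hk : l1 (cmod M z) = k := by omega
      rw [comb_step hsol hlow hin]
      exact (skewAdjoint _).sub_mem (Ad_mem_skewAdjoint ((unitaryUnits _).inv_mem (hW z μ)) (ih z hk)) (hX z μ hlow hin)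

include hM hξ0 hsol in
/-- **PERIODICITY**: `W` and `X` `(N·M)`-periodic ⟹ `ξ` is `(N·M)`-periodic. [folklore] -/
theorem periodic_of_combSolve {N : ℕ} (hWP : IsPeriodicCfg W ((N * M : ℕ) : ℤ)) (hXP : IsPeriodicDir X ((N * M : ℕ) : ℤ)) :
    ∀ (y : Site d) (i : Fin d), ξ (y + ((N * M : ℕ) : ℤ) • e i) = ξ y := by
  have hper : ∀ (y : Site d) (i : Fin d), cmod M (y + ((N * M : ℕ) : ℤ) • e i) = cmod M y := fun y i => by
    have h := cmod_add_period (L := M) (N : ℤ) y i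
    rwa [show ((M : ℤ) * (N : ℤ)) = ((N * M : ℕ) : ℤ) by push_cast; ring] at h
  suffices h : ∀ (k : ℕ) (y : Site d), l1 (cmod M y) = k → ∀ i : Fin d, ξ (y + ((N * M : ℕ) : ℤ) • e i) = ξ y by
    intro y i; exact h _ y rfl i
  intro k
  induction k with
  | zero =>
      intro y hy i
      have hy0 : cmod M y = 0 := eq_zero_of_l1_eq_zero hy
      rw [eq_zero_of_cmod_eq_zero hξ0 hy0, eq_zero_of_cmod_eq_zero hξ0 (by rw [hper, hy0])]
  | succ k ih =>
      intro y hy i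
      have hy0 : cmod M y ≠ 0 := fun h => by rw [h] at hy; simp [l1] at hy
      obtain ⟨z, μ, rfl, hlow, hin, hl1⟩ := exists_comb_pred hM hy0
      have hk : l1 (cmod M z) = k := by omega
      have hlow' : ∀ κ, κ < μ → cmod M (z + ((N * M : ℕ) : ℤ) • e i) κ = 0 := fun κ hκ => by rw [hper]; exact hlow κ hκ
      have hin' : cmod M (z + ((N * M : ℕ) : ℤ) • e i) μ + 1 < (M : ℤ) := by rw [hper]; exact hin
      rw [show z + e μ + ((N * M : ℕ) : ℤ) • e i = z + ((N * M : ℕ) : ℤ) • e i + e μ by abel,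
        comb_step hsol hlow' hin', comb_step hsol hlow hin, hWP z i μ, hXP z i μ, ih z hk i]

include hsol in
/-- The decomposed field `X − gaugeDir W ξ` VANISHES on the in-block comb bonds (membership in the comb slice). [folklore] -/
theorem comb_vanish_of_combSolve (z : Site d) (μ : Fin d) (hlow : ∀ κ, κ < μ → cmod M z κ = 0) (hin : cmod M z μ + 1 < (M : ℤ)) :
    X z μ - gaugeDir W ξ z μ = 0 := by
  rw [hsol z μ hlow hin, sub_self]

end Solve

/-! ## §3 Sums along tree words -/

/-- `Σ` along `seg κ (m+1)` = `Σ` along `seg κ m` plus the next bond. [folklore] -/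
theorem asum_seg_natCast_succ (A : Site d → Fin d → Matrix n n ℂ) (z : Site d) (κ : Fin d) (m : ℕ) :
    asum A z (seg κ ((m : ℤ) + 1)) = asum A z (seg κ m) + A (z + (m : ℤ) • e κ) κ := by
  rw [show (m : ℤ) + 1 = ((m + 1 : ℕ) : ℤ) by push_cast; rfl, seg_natCast, seg_natCast, List.replicate_succ', asum_append,
    disp_replicate]
  simp [stepA, Letter.vec]

/-- **THE TREE-WORD SUM GROWS BY THE LAST BOND**: if the coordinates of `v` below `μ` vanish and `v_μ ≥ 0`, then
`asum A q (treeWord (v + e_μ)) = asum A q (treeWord v) + A (q + v) μ` (the comb `Γ_{q, q+v+e_μ}` is `Γ_{q,q+v}` followed by the bond `(q+v, μ)`). [folklore] -/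
theorem asum_treeWord_add_e (A : Site d → Fin d → Matrix n n ℂ) (q v : Site d) (μ : Fin d)
    (hlow : ∀ κ, κ < μ → v κ = 0) (hv : 0 ≤ v μ) :
    asum A q (treeWord (v + e μ)) = asum A q (treeWord v) + A (q + v) μ := by
  obtain ⟨s, t, hst⟩ := List.append_of_mem (a := μ) (l := (List.finRange d).reverse) (by simp)
  have hpw := pairwise_gt_finRange_reverse d
  rw [hst] at hpw
  have ht : ∀ κ ∈ t, κ < μ := fun κ hκ => List.rel_of_pairwise_cons (List.pairwise_append.mp hpw).2.1 hκ
  have hnd : (s ++ μ :: t).Nodup := by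
    rw [← hst]; exact List.nodup_reverse.mpr (List.nodup_finRange d)
  have hμst : μ ∉ s ++ t := (List.nodup_cons.mp (List.nodup_middle.mp hnd)).1
  rw [List.mem_append, not_or] at hμst
  have hne : ∀ κ, κ ≠ μ → seg κ ((v + e μ) κ) = seg κ (v κ) := by
    intro κ hκ; simp [e, hκ]
  have hμμ : seg μ ((v + e μ) μ) = seg μ (v μ + 1) := by simp [e]
  have htnil : t.flatMap (fun κ => seg κ (v κ)) = [] :=
    List.flatMap_eq_nil_iff.mpr fun κ hκ => by rw [hlow κ (ht κ hκ), seg_zero]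
  have h1 : treeWord v = s.flatMap (fun κ => seg κ (v κ)) ++ seg μ (v μ) := by
    rw [treeWord, hst, List.flatMap_append, List.flatMap_cons, htnil, List.append_nil]
  have h2 : treeWord (v + e μ) = s.flatMap (fun κ => seg κ (v κ)) ++ seg μ (v μ + 1) := by
    rw [treeWord, hst, List.flatMap_append, List.flatMap_cons, hμμ,
      flatMap_congr_of (s := s) (fun κ hκ => hne κ (fun h => hμst.1 (h ▸ hκ))),
      flatMap_congr_of (s := t) (fun κ hκ => hne κ (fun h => hμst.2 (h ▸ hκ))), htnil, List.append_nil]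
  obtain ⟨m, hm⟩ := Int.eq_ofNat_of_zero_le hv
  have hdisp : q + disp (s.flatMap (fun κ => seg κ (v κ))) + (m : ℤ) • e μ = q + v := by
    have h := disp_treeWord v
    rw [h1, disp_append, disp_seg, hm] at h
    rw [add_assoc, h]
  rw [h2, h1, asum_append, asum_append, hm, asum_seg_natCast_succ, hdisp, add_assoc]

/-! ## §4 Existence: the closed formula along the comb transport -/

/-- **EXISTENCE OF THE COMB GENERATOR** — for EVERY configuration `W` (no unitarity, no smallness), every `M ≥ 1` and every 1-form `X` there is a CORNER-TRIVIAL `ξ` with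
`gaugeDir W ξ = X` on every in-block comb bond.  Witness: `ξ(y) = −Ad_{btree(y)⁻¹} · asum (b ↦ Ad_{btree(b⁺)} X(b)) (M•⌊y∕M⌋) (treeWord (y mod M))` (`btree` = row NE3's
comb transport from the block corner); on a comb bond `(z, μ)` the comb of `z + e_μ` is the comb of `z` plus that bond (`asum_treeWord_add_e`), and
`btree(z)·W(z,μ) = btree(z+e_μ)` (`NE3CombGauge.comb_eq_one_of_lowPart`). [folklore] -/
theorem exists_combSolve (W : Site d → Fin d → (Matrix n n ℂ)ˣ) {M : ℕ} (hM : 1 ≤ M) (X : Site d → Fin d → Matrix n n ℂ) :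
    ∃ ξ : Site d → Matrix n n ℂ, (∀ w : Site d, ξ ((M : ℤ) • w) = 0) ∧
      ∀ (z : Site d) (μ : Fin d), (∀ κ, κ < μ → cmod M z κ = 0) → cmod M z μ + 1 < (M : ℤ) → gaugeDir W ξ z μ = X z μ := by
  refine ⟨fun y => -Ad (btree M W (cdiv M y) y)⁻¹
      (asum (fun y' μ' => Ad (btree M W (cdiv M y) (y' + e μ')) (X y' μ')) ((M : ℤ) • cdiv M y) (treeWord (cmod M y))), ?_, ?_⟩
  · intro w
    simp only [cmod_corner hM w, treeWord_zero, asum_nil, Ad_zero, neg_zero]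
  · intro z μ hlow hin
    -- block data of `z` and of `z + e μ` (same block)
    set c : Site d := cdiv M z with hc
    set v : Site d := cmod M z with hv
    have hz : z = (M : ℤ) • c + v := (smul_cdiv_add_cmod M z).symm
    have hq0 : ∀ i, 0 ≤ (v + e μ) i := fun i => by
      simp only [Pi.add_apply, e_apply]
      have := cmod_nonneg hM z i
      split_ifs <;> simp only [hv] <;> omega
    have hqM : ∀ i, (v + e μ) i < M := fun i => by
      simp only [Pi.add_apply, e_apply]
      have := cmod_lt hM z i
      split_ifs with h
      · subst h; simp only [hv]; omega
      · simp only [hv]; omega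
    have hrepr : z + e μ = (M : ℤ) • c + (v + e μ) := by rw [hz]; abel
    have hc' : cdiv M (z + e μ) = c := cdiv_eq_of_repr hrepr hq0 hqM
    have hv' : cmod M (z + e μ) = v + e μ := cmod_eq_of_repr hrepr hq0 hqM
    -- the comb bond is trivial in the comb gauge: `btree(z)·W(z,μ) = btree(z + e μ)`
    have hlp : lowPart μ (z - (M : ℤ) • c) = 0 := by
      rw [show z - (M : ℤ) • c = v by rw [hz]; abel]
      exact (lowPart_eq_zero_iff μ v).mpr hlow
    have hcomb := comb_eq_one_of_lowPart M W c z μ hlp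
    simp only [gaugeAct] at hcomb
    have hB : btree M W c z * W z μ = btree M W c (z + e μ) := by
      have h := congrArg (· * btree M W c (z + e μ)) hcomb
      simpa [mul_assoc] using h
    have hBinv : (W z μ)⁻¹ * (btree M W c z)⁻¹ = (btree M W c (z + e μ))⁻¹ := by
      rw [← hB, mul_inv_rev]
    -- the tree-word sum grows by the bond `(z, μ)`
    set A : Site d → Fin d → Matrix n n ℂ := fun y' μ' => Ad (btree M W c (y' + e μ')) (X y' μ') with hA
    have hsum : asum A ((M : ℤ) • c) (treeWord (v + e μ)) = asum A ((M : ℤ) • c) (treeWord v) + A ((M : ℤ) • c + v) μ :=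
      asum_treeWord_add_e A _ v μ hlow (cmod_nonneg hM z μ)
    -- assemble
    show Ad (W z μ)⁻¹ (-Ad (btree M W (cdiv M z) z)⁻¹ (asum (fun y' μ' => Ad (btree M W (cdiv M z) (y' + e μ')) (X y' μ'))
        ((M : ℤ) • cdiv M z) (treeWord (cmod M z))))
      - -Ad (btree M W (cdiv M (z + e μ)) (z + e μ))⁻¹ (asum (fun y' μ' => Ad (btree M W (cdiv M (z + e μ)) (y' + e μ')) (X y' μ'))
        ((M : ℤ) • cdiv M (z + e μ)) (treeWord (cmod M (z + e μ)))) = X z μ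
    rw [hc', hv', ← hc, ← hv, ← hA, hsum, Ad_add, Ad_neg, ← Ad_mul, hBinv]
    have hlast : A ((M : ℤ) • c + v) μ = Ad (btree M W c (z + e μ)) (X z μ) := by rw [hA, ← hz]
    rw [hlast, Ad_inv_Ad]
    abel

end

end Summit.QuantumFields.BalabanUV.T4Continuum.NE7CombGenerator
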